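import Summits.ResolutionOfSingularities.KangarooAtlas.MizutaniExtremalStep
import Summits.ResolutionOfSingularities.KangarooAtlas.MizutaniSixOps
import HarnessLib

/-!
# Mizutani's Thm. 2.8, second part, Step (II) for ALL `p`: the extremal scheme lives in `ℙ^{2p−1}` with ONE invariant form

Cell `pub-rosobs`, Mizutani enclosure (seat mizutani-encloser-2, gen 7). AI-written; AI review is weaker than expert
review; NOT a resolution-of-singularities theorem (summit relevance C).

Mizutani (Nagoya Math. J. 52 (1973) p. 91–92, Steps (I)–(II)): «`[K : k^p] = p²` … `dim_K Diff_2(k)f = dim_K Diff_2(K/k^p)f = 5`.  But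
`dim_K Diff_2(K/k^p) = 6`, thus there exists `D` in `Diff_2(K/k^p)` such that `D ≠ 0` and `D(f) = 0` … by Lemma 2.9 below `dim c(f*) ≤ 2p`
… hence `dim V = v = 1`».  Gen 6 proved the case `p = 2` (`MizutaniExtremalTwo.lean`).  This file proves it for all `p`, on the point side: for the
extremal point `𝔭 = [c^{1/p}]` (`MizutaniExtremalStep.exists_adapted_pair_of_extremal`: `{c_i} ⊆ K' = k^p(y_1, y_2)`, `dim Θ_2(c) = 5` for odd `p`)
the six operators `1, ∂_1, ∂_2, ∂_1², ∂_1∂_2, ∂_2²` of the two-generator tower `K'/k^p` (`MizutaniSixOps.lean`) applied to `c` are `K'`-dependent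
(restriction of the derivations of the envelope `k^p(b) ⊇ y`, `der_coe_eq`; a `K'`-linear retraction `k → K'`), and
`MizutaniSixOps.card_le_two_mul_of_sixOps` (encloser-1's `IsRootTower.finrank_ker_le_two_mul` = MIZUTANI'S LEMMA 2.9 (1)) gives `n + 1 ≤ 2p`:

* `IsRootTower.derivation_apply_eq_of_gen` (derivations of a tower agree if they agree on the generators), **`der_coe_eq`** (the derivations of
  `k^p(y) ⊆ k^p(b)` are the restrictions of those of `k^p(b)`);
* **`exists_annihilator_of_extremal`** (`p` odd) — the extremal point is `[c^{1/p}]`, `{c_i} ⊆ k^p(y_1,y_2)`, and a nonzero second-order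
  `D = Σ ν_t op_t` with `D(1) = D(y_j) = 0` has **`ker D = span_{k^p}{c_i}`** of dimension `2p = n + 1` (the interface to Lemma 2.9 (2));
* **`card_eq_of_extremal`** — ALL `p`: no linear form, `(L_B)_1 ≠ 0`, `dim B + 1 = 2p` at level one ⇒ `n + 1 = 2p` and `dim (L_B)_1 = 1`;
* **`exists_pair_of_extremal`** — … and `𝔭 = [1^{1/p} : c_1^{1/p} : ⋯ : c_{2p−1}^{1/p}]` with the `2p` `k^p`-independent `c_i` inside the field
  `k^p(y_1, y_2)` of degree `p²`, `y ⊆ {c_i}`; `exists_pair_of_exponent_eq_one` (Hironaka's vocabulary).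

NOT PROVED: the normal form `span_{k^p}{c_i} = λ·(k^p(y_1) ⊕ k^p(y_1)·y_2)` («same type as Example 2.1» for odd `p`), which is Mizutani's
Lemma 2.9 (2), only outlined in print.

## References

* H. Mizutani, *Hironaka's additive group schemes*, Nagoya Math. J. 52 (1973) 85–95, Thm. 2.8 (second part), Steps (I)–(II), Lemma 2.9 (1).
  [Mizutani1973HironakaGroupSchemes]
-/

noncomputable section

open MvPolynomial TensorProduct Literature.AlgebraicGeometry.Resolution
  Literature.AlgebraicGeometry.Resolution.HironakaScheme

namespace Summit.ResolutionOfSingularities.KangarooAtlas.Mizutani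

universe u

/-! ## Derivations of nested envelopes `k^p(y) ⊆ k^p(b)` -/

section Nested

variable {L K : Type u} [Field L] [Field K] [Algebra L K] {s p e : ℕ} [hp : Fact p.Prime] [CharP K p]
  {x : Fin s → L} {a : Fin s → K}

omit [CharP K p] in
/-- Two `L`-derivations of a tower into any module agreeing on the generators `a_i` agree. [folklore] -/
theorem IsRootTower.derivation_apply_eq_of_gen (h : IsRootTower L K (p ^ e) x a) {M : Type*} [AddCommGroup M] [Module K M]
    [Module L M] [IsScalarTower L K M] {D₁ D₂ : Derivation L K M} (hgen : ∀ i, D₁ (a i) = D₂ (a i)) (y : K) : D₁ y = D₂ y := by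
  haveI := h.finiteDimensional
  have halg : ∀ z ∈ Set.range a, IsAlgebraic L z := fun z _ => Algebra.IsAlgebraic.isAlgebraic z
  have hy : y ∈ Algebra.adjoin L (Set.range a) := by
    rw [← IntermediateField.adjoin_toSubalgebra_of_isAlgebraic halg]
    exact h.mem_adjoin_range y
  exact Derivation.eqOn_adjoin (s := Set.range a) (by rintro _ ⟨i, rfl⟩; exact hgen i) hy

end Nested

section Envelope

variable {k : Type u} [Field k] {p : ℕ} [hp : Fact p.Prime] [CharP k p]

/-- `k^p(y) ⊆ k^p(b)` for `y ⊆ b`. [folklore] -/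
theorem towerField_le_of_subset {s r : ℕ} {b : Fin s → k} {y : Fin r → k} (hyb : Set.range y ⊆ Set.range b) :
    towerField 1 y ≤ towerField 1 b :=
  IntermediateField.adjoin.mono _ _ _ hyb

/-- **The derivations of `k^p(y)` are the restrictions of those of `k^p(b) ⊇ k^p(y)`** (`b ⊇ y` `p`-independent; `∂_{y_j} = ∂_{b_l}` on `k^p(y)` for
`b_l = y_j`): both are derivations of `k^p(y)` into `k` with the same values `−δ` on the generators `y`. [cite: EGAIV4, Thm. 16.11.2] -/
theorem der_coe_eq {s r : ℕ} {b : Fin s → k} {y : Fin r → k} (hb : PIndep p 1 b) (hy : PIndep p 1 y)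
    (hyb : Set.range y ⊆ Set.range b) {j : Fin r} {l : Fin s} (hl : b l = y j) (z : towerField 1 y) :
    (((isRootTower_adjoin (e := 1) hy).der le_rfl j z : towerField 1 y) : k) =
      (((isRootTower_adjoin (e := 1) hb).der le_rfl l (IntermediateField.inclusion (towerField_le_of_subset hyb) z) :
        towerField 1 b) : k) := by
  set K₁ := frobPow k p 1
  set h' := isRootTower_adjoin (k := k) (p := p) (e := 1) hy with hh'
  set h := isRootTower_adjoin (k := k) (p := p) (e := 1) hb with hh
  set ι₁ := IntermediateField.inclusion (towerField_le_of_subset hyb) with hι₁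
  have hbinj : Function.Injective b := GenAtt.injective_of_pIndep hb
  have hyinj : Function.Injective y := GenAtt.injective_of_pIndep hy
  -- the two derivations `k^p(y) → k`
  let D₁ : Derivation K₁ (towerField 1 y) k := (Algebra.linearMap (towerField 1 y) k).compDer (h'.der le_rfl j)
  let φ : towerField 1 y →ₗ[K₁] k :=
    (towerField 1 b).val.toLinearMap ∘ₗ ((h.der le_rfl l : Derivation K₁ (towerField 1 b) (towerField 1 b)) :
      towerField 1 b →ₗ[K₁] towerField 1 b) ∘ₗ ι₁.toLinearMap
  have hφ : ∀ z : towerField 1 y, φ z = ((h.der le_rfl l (ι₁ z) : towerField 1 b) : k) := fun z => rfl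
  let D₂ : Derivation K₁ (towerField 1 y) k := Derivation.mk' φ fun z w => by
    rw [hφ, hφ, hφ, map_mul, Derivation.leibniz, IntermediateField.coe_add, smul_eq_mul, smul_eq_mul,
      IntermediateField.coe_mul, IntermediateField.coe_mul, IntermediateField.coe_inclusion, IntermediateField.coe_inclusion,
      IntermediateField.smul_def, IntermediateField.smul_def, smul_eq_mul, smul_eq_mul]
  have hD₁ : ∀ z, D₁ z = ((h'.der le_rfl j z : towerField 1 y) : k) := fun z => rfl
  have hD₂ : ∀ z, D₂ z = ((h.der le_rfl l (ι₁ z) : towerField 1 b) : k) := fun z => rfl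
  rw [← hD₁, ← hD₂]
  refine h'.derivation_apply_eq_of_gen (fun j' => ?_) z
  rw [hD₁, hD₂, h'.der_gen le_rfl]
  have hgen : ι₁ (towerGen 1 y j') = towerGen 1 b (Classical.choose (hyb ⟨j', rfl⟩)) := by
    apply Subtype.ext
    rw [IntermediateField.coe_inclusion, coe_towerGen, coe_towerGen]
    exact (Classical.choose_spec (hyb ⟨j', rfl⟩)).symm
  rw [hgen, h.der_gen le_rfl]
  have hiff : Classical.choose (hyb ⟨j', rfl⟩) = l ↔ j' = j := by
    constructor
    · intro hjl
      have := Classical.choose_spec (hyb ⟨j', rfl⟩)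
      rw [hjl, hl] at this
      exact hyinj this.symm
    · rintro rfl
      apply hbinj
      rw [Classical.choose_spec (hyb ⟨j', rfl⟩), hl]
  by_cases hj' : j' = j
  · rw [if_pos hj', if_pos (hiff.mpr hj')]; simp
  · rw [if_neg hj', if_neg (fun h' => hj' (hiff.mp h'))]; simp

end Envelope

/-! ## Step (II): `n + 1 = 2p` for all `p` -/

section StepTwo

variable (k : Type u) [Field k] (p : ℕ) [hp : Fact p.Prime] [CharP k p] {n : ℕ}
  (𝔭 : Ideal (MvPolynomial (Fin (n + 1)) k))

set_option maxHeartbeats 400000 in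
/-- **THE SECOND-ORDER ANNIHILATOR OF THE EXTREMAL POINT, `p` odd** (Mizutani's Steps (I)–(II) with Lemma 2.9 (1)): the extremal point is
`[c^{1/p}]` with `{c_i} ⊆ k^p(y_1, y_2)` (`y ⊆ {c_i}` a `p`-independent pair), and there is an operator `D ≠ 0` of order `≤ 2` on `k^p(y_1,y_2)`
over `k^p` — a combination of `1, ∂_0, ∂_1, ∂_0², ∂_0∂_1, ∂_1²` — with `D(1) = D(y_j) = 0`, killing every `c_i`, `dim_{k^p} ker D = 2p`, `n + 1 = 2p`
and **`ker D = span_{k^p}{c_i}`** («`c(f) = ker D`»; this is the interface to Lemma 2.9 (2), the normal form).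
[cite: Mizutani1973HironakaGroupSchemes, proof of Thm. 2.8, Steps (I)–(II) and Lemma 2.9 (1) (p. 91–94)] -/
theorem exists_annihilator_of_extremal (hp2 : p ≠ 2) (hP : IsPoint k 𝔭) (h0 : invForms k p 𝔭 0 = ⊥) (hV : invForms k p 𝔭 1 ≠ ⊥)
    (hdim : n + 2 = 2 * p + Module.finrank k (invForms k p 𝔭 1)) :
    ∃ (c : Fin (n + 1) → k) (y : Fin 2 → k) (hy : PIndep p 1 y) (hc : ∀ i, c i ∈ towerField 1 y) (ν : Fin 6 → towerField 1 y)
      (D : towerField 1 y →ₗ[frobPow k p 1] towerField 1 y),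
      c 0 = 1 ∧ LinearIndependent (frobPow k p 1) c ∧ 𝔭 = ratPoint k p 1 c ∧ Set.range y ⊆ Set.range c ∧
      D = ∑ t, ν t • (isRootTower_adjoin (e := 1) hy).sixOps t ∧ IsDiffOpLE (frobPow k p 1) 2 D ∧ D ≠ 0 ∧ D 1 = 0 ∧
      (∀ j, D (towerGen 1 y j) = 0) ∧ (∀ i, D ⟨c i, hc i⟩ = 0) ∧ n + 1 = 2 * p ∧
      Module.finrank (frobPow k p 1) (LinearMap.ker D) = 2 * p ∧
      LinearMap.ker D = Submodule.span (frobPow k p 1) (Set.range fun i => (⟨c i, hc i⟩ : towerField 1 y)) := by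
  classical
  obtain ⟨c, y, s, b, hb, hc, hc0, hcind, heq, hy, hyc, hcy, hyb, hprof⟩ :=
    exists_adapted_pair_of_extremal k p 𝔭 hP h0 hV hdim
  set h := isRootTower_adjoin (k := k) (p := p) (e := 1) hb with hh
  set h' := isRootTower_adjoin (k := k) (p := p) (e := 1) hy with hh'
  have hcy' : ∀ i, c i ∈ towerField 1 y := fun i => hcy ⟨i, rfl⟩
  set v : Fin (n + 1) → towerField 1 b := fun i => ⟨c i, hc i⟩ with hv
  set v' : Fin (n + 1) → towerField 1 y := fun i => ⟨c i, hcy' i⟩ with hv'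
  set ι₁ := IntermediateField.inclusion (towerField_le_of_subset hyb) with hι₁
  have hι₁v : ∀ i, ι₁ (v' i) = v i := fun i => Subtype.ext (by rw [hι₁, IntermediateField.coe_inclusion])
  -- indices of `y` inside `b`
  have hl : ∀ j : Fin 2, ∃ l : Fin s, b l = y j := fun j => by
    obtain ⟨l, hl⟩ := hyb ⟨j, rfl⟩; exact ⟨l, hl⟩
  choose lx hlx using hl
  -- compatibility of the derivations of `k^p(y)` with those of the envelope `k^p(b)`
  have hcompat : ∀ j z, ι₁ (h'.dlin j z) = h.der le_rfl (lx j) (ι₁ z) := fun j z =>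
    Subtype.ext (by rw [hι₁, IntermediateField.coe_inclusion, h'.dlin_apply]; exact der_coe_eq hb hy hyb (hlx j) z)
  have hcompatv : ∀ j i, ι₁ (h'.dlin j (v' i)) = h.dvec (lx j) v i := fun j i => by
    rw [hcompat, hι₁v, h.dvec_apply, h.der_apply]
  have hcompatvv : ∀ j j' i, ι₁ (h'.dlin j (h'.dlin j' (v' i))) = h.dvec (lx j) (h.dvec (lx j') v) i := fun j j' i => by
    rw [hcompat, h.dvec_apply, h.der_apply, h.dvec_apply, hcompatv, h.dvec_apply]
  -- the six vectors of the envelope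
  let Ops : Fin 6 → (Fin (n + 1) → towerField 1 b) :=
    ![v, h.dvec (lx 0) v, h.dvec (lx 1) v, h.dvec (lx 0) (h.dvec (lx 0) v), h.dvec (lx 0) (h.dvec (lx 1) v),
      h.dvec (lx 1) (h.dvec (lx 1) v)]
  have hv1 : ∀ l, h.dvec l v ∈ h.thetaSpan 2 v := fun l =>
    h.thetaSpan_mono (by norm_num) v (h.dvec_mem_thetaSpan_succ le_rfl v l (h.self_mem_thetaSpan 0 v))
  have hv2 : ∀ l l', h.dvec l (h.dvec l' v) ∈ h.thetaSpan 2 v := fun l l' =>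
    h.dvec_mem_thetaSpan_succ le_rfl v l (h.dvec_mem_thetaSpan_succ le_rfl v l' (h.self_mem_thetaSpan 0 v))
  have hOps : ∀ t, Ops t ∈ h.thetaSpan 2 v := by
    have e0 : Ops 0 = v := rfl
    have e1 : Ops 1 = h.dvec (lx 0) v := rfl
    have e2 : Ops 2 = h.dvec (lx 1) v := rfl
    have e3 : Ops 3 = h.dvec (lx 0) (h.dvec (lx 0) v) := rfl
    have e4 : Ops 4 = h.dvec (lx 0) (h.dvec (lx 1) v) := rfl
    have e5 : Ops 5 = h.dvec (lx 1) (h.dvec (lx 1) v) := rfl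
    intro t
    fin_cases t
    · rw [show ((⟨0, by norm_num⟩ : Fin 6)) = 0 from rfl, e0]; exact h.self_mem_thetaSpan 2 v
    · rw [show ((⟨1, by norm_num⟩ : Fin 6)) = 1 from rfl, e1]; exact hv1 _
    · rw [show ((⟨2, by norm_num⟩ : Fin 6)) = 2 from rfl, e2]; exact hv1 _
    · rw [show ((⟨3, by norm_num⟩ : Fin 6)) = 3 from rfl, e3]; exact hv2 _ _
    · rw [show ((⟨4, by norm_num⟩ : Fin 6)) = 4 from rfl, e4]; exact hv2 _ _
    · rw [show ((⟨5, by norm_num⟩ : Fin 6)) = 5 from rfl, e5]; exact hv2 _ _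
  have hOpsops : ∀ t i, ι₁ (h'.sixOps t (v' i)) = Ops t i := by
    have e0 : ∀ z, h'.sixOps 0 z = z := fun z => rfl
    have e1 : ∀ z, h'.sixOps 1 z = h'.dlin 0 z := fun z => rfl
    have e2 : ∀ z, h'.sixOps 2 z = h'.dlin 1 z := fun z => rfl
    have e3 : ∀ z, h'.sixOps 3 z = h'.dlin 0 (h'.dlin 0 z) := fun z => rfl
    have e4 : ∀ z, h'.sixOps 4 z = h'.dlin 0 (h'.dlin 1 z) := fun z => rfl
    have e5 : ∀ z, h'.sixOps 5 z = h'.dlin 1 (h'.dlin 1 z) := fun z => rfl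
    have f0 : ∀ i, Ops 0 i = v i := fun i => rfl
    have f1 : ∀ i, Ops 1 i = h.dvec (lx 0) v i := fun i => rfl
    have f2 : ∀ i, Ops 2 i = h.dvec (lx 1) v i := fun i => rfl
    have f3 : ∀ i, Ops 3 i = h.dvec (lx 0) (h.dvec (lx 0) v) i := fun i => rfl
    have f4 : ∀ i, Ops 4 i = h.dvec (lx 0) (h.dvec (lx 1) v) i := fun i => rfl
    have f5 : ∀ i, Ops 5 i = h.dvec (lx 1) (h.dvec (lx 1) v) i := fun i => rfl
    intro t i
    fin_cases t
    · rw [show ((⟨0, by norm_num⟩ : Fin 6)) = 0 from rfl, e0, f0]; exact hι₁v i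
    · rw [show ((⟨1, by norm_num⟩ : Fin 6)) = 1 from rfl, e1, f1]; exact hcompatv 0 i
    · rw [show ((⟨2, by norm_num⟩ : Fin 6)) = 2 from rfl, e2, f2]; exact hcompatv 1 i
    · rw [show ((⟨3, by norm_num⟩ : Fin 6)) = 3 from rfl, e3, f3]; exact hcompatvv 0 0 i
    · rw [show ((⟨4, by norm_num⟩ : Fin 6)) = 4 from rfl, e4, f4]; exact hcompatvv 0 1 i
    · rw [show ((⟨5, by norm_num⟩ : Fin 6)) = 5 from rfl, e5, f5]; exact hcompatvv 1 1 i
  -- `dim Θ_2(c) = 5 < 6`: the six vectors are dependent over `k^p(b)`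
  have hΘ2 : Module.finrank (towerField 1 b) (h.thetaSpan 2 v) = 5 := by
    have h3 : 2 < p := lt_of_le_of_ne hp.out.two_le (Ne.symm hp2)
    have := hprof 2 (by omega)
    omega
  have hdep : ¬ LinearIndependent (towerField 1 b) Ops := by
    intro hind
    haveI := h.thetaSpan_finite 2 v
    have hres : LinearIndependent (towerField 1 b) (fun t => (⟨Ops t, hOps t⟩ : h.thetaSpan 2 v)) :=
      LinearIndependent.of_comp (h.thetaSpan 2 v).subtype (by exact hind)
    have := hres.fintype_card_le_finrank
    rw [Fintype.card_fin, hΘ2] at this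
    omega
  obtain ⟨g, hg, t₀, ht₀⟩ := Fintype.not_linearIndependent_iff.mp hdep
  let μ : Fin 6 → towerField 1 b := fun t => (g t₀)⁻¹ * g t
  have hμt₀ : μ t₀ = 1 := by show (g t₀)⁻¹ * g t₀ = 1; exact inv_mul_cancel₀ ht₀
  have hμrel : ∀ i, ∑ t, μ t * Ops t i = 0 := fun i => by
    have h1 := congrFun hg i
    rw [Finset.sum_apply, Pi.zero_apply] at h1
    simp only [Pi.smul_apply, smul_eq_mul] at h1
    calc ∑ t, μ t * Ops t i = ∑ t, (g t₀)⁻¹ * (g t * Ops t i) :=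
          Finset.sum_congr rfl fun t _ => by show (g t₀)⁻¹ * g t * Ops t i = _; rw [mul_assoc]
      _ = (g t₀)⁻¹ * ∑ t, g t * Ops t i := by rw [Finset.mul_sum]
      _ = 0 := by rw [h1, mul_zero]
  -- read in `k` and retract to `k^p(y)`
  let G : Set (Fin 6 → towerField 1 y) := {g6 | ∃ i, g6 = fun t => h'.sixOps t (v' i)}
  obtain ⟨ν, hνt₀, hν⟩ := exists_rational_perp (towerField 1 y) (G := G) (w₀ := fun t => (μ t : k)) (u₀ := t₀)
    (by show ((μ t₀ : towerField 1 b) : k) = 1; rw [hμt₀]; rfl) (by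
      rintro _ ⟨i, rfl⟩
      have := congrArg ((↑) : towerField 1 b → k) (hμrel i)
      rw [IntermediateField.coe_sum] at this
      simp only [IntermediateField.coe_mul, IntermediateField.coe_zero] at this
      rw [← this]
      refine Finset.sum_congr rfl fun t _ => ?_
      rw [← hOpsops t i, IntermediateField.coe_inclusion])
  -- the generic second-order annihilator
  have hv'ind : LinearIndependent (frobPow k p 1) v' :=
    LinearIndependent.of_comp ((towerField 1 y).val.toLinearMap.restrictScalars (frobPow k p 1)) (by exact hcind)
  have hv'0 : v' 0 = 1 := Subtype.ext (by rw [hv']; exact hc0)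
  have ha : ∀ j, ∃ i, v' i = towerGen 1 y j := fun j => by
    obtain ⟨i, hi⟩ := hyc ⟨j, rfl⟩
    exact ⟨i, Subtype.ext (by rw [coe_towerGen, hv']; exact hi)⟩
  have hν0 : ν ≠ 0 := fun h0 => by
    have := congrFun h0 t₀
    rw [hνt₀, Pi.zero_apply] at this
    exact one_ne_zero this
  obtain ⟨D, hDdef, hDord, hD0, hD1, hDa, hDv, hker, hcard, hkereq⟩ :=
    h'.exists_secondOrder_of_sixOps hp2 hv'ind ⟨0, hv'0⟩ ha hν0 fun i => hν _ ⟨i, rfl⟩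
  rw [Fintype.card_fin] at hcard hkereq
  have hd : 0 < Module.finrank k (invForms k p 𝔭 1) :=
    Module.finrank_pos_iff.mpr ((Submodule.nontrivial_iff_ne_bot).mpr hV)
  have hn : n + 1 = 2 * p := by omega
  exact ⟨c, y, hy, hcy', ν, D, hc0, hcind, heq, hyc, hDdef, hDord, hD0, hD1, hDa, hDv, hn, by omega, hkereq hn⟩

/-- **`n + 1 ≤ 2p` for the extremal point, `p` odd.** [cite: Mizutani1973HironakaGroupSchemes, proof of Thm. 2.8, Step (II) (p. 92)] -/
theorem card_le_of_extremal_odd (hp2 : p ≠ 2) (hP : IsPoint k 𝔭) (h0 : invForms k p 𝔭 0 = ⊥) (hV : invForms k p 𝔭 1 ≠ ⊥)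
    (hdim : n + 2 = 2 * p + Module.finrank k (invForms k p 𝔭 1)) : n + 1 ≤ 2 * p := by
  obtain ⟨-, -, -, -, -, -, -, -, -, -, -, -, -, -, -, -, hn, -, -⟩ := exists_annihilator_of_extremal k p 𝔭 hp2 hP h0 hV hdim
  exact hn.le

/-- **MIZUTANI'S THM. 2.8, SECOND PART, STEP (II), ALL `p`: the extremal scheme lives in `ℙ^{2p−1}` with ONE invariant form** — a point of
`ℙ^n_k` through which no linear form passes, with `(L_B)_1 ≠ 0` and `dim B(𝔭) + 1 = 2p` read at level one, has `n + 1 = 2p` and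
`dim (L_B)_1 = 1` («hence `dim V = v = 1`»). [cite: Mizutani1973HironakaGroupSchemes, Thm. 2.8 (second part), proof, Step (II) (p. 92)] -/
theorem card_eq_of_extremal (hP : IsPoint k 𝔭) (h0 : invForms k p 𝔭 0 = ⊥) (hV : invForms k p 𝔭 1 ≠ ⊥)
    (hdim : n + 2 = 2 * p + Module.finrank k (invForms k p 𝔭 1)) :
    n + 1 = 2 * p ∧ Module.finrank k (invForms k p 𝔭 1) = 1 := by
  by_cases hp2 : p = 2
  · exact card_eq_of_extremal_two k p 𝔭 hp2 hP h0 hV hdim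
  · have hle := card_le_of_extremal_odd k p 𝔭 hp2 hP h0 hV hdim
    have hd : 0 < Module.finrank k (invForms k p 𝔭 1) :=
      Module.finrank_pos_iff.mpr ((Submodule.nontrivial_iff_ne_bot).mpr hV)
    omega

/-- **THE EXTREMAL POINT, ALL `p`**: under the hypotheses of Thm. 2.8's second part (no linear form, not a vector group at level one,
`dim B + 1 = 2p`), `n + 1 = 2p` and `𝔭 = [1^{1/p} : c_1^{1/p} : ⋯ : c_{2p−1}^{1/p}]` with `2p` `k^p`-independent coordinates `c_i` lying in the
field `k^p(y_1, y_2)` of degree `p²` generated by a `p`-independent pair `y ⊆ {c_i}` («`[K : k^p] = p²`»).  The normal form of the span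
(«same type as Example 2.1») is Mizutani's Lemma 2.9 (2) and is NOT asserted here.
[cite: Mizutani1973HironakaGroupSchemes, Thm. 2.8 (second part), proof, Steps (I)–(II) (p. 91–92)] -/
theorem exists_pair_of_extremal (hP : IsPoint k 𝔭) (h0 : invForms k p 𝔭 0 = ⊥) (hV : invForms k p 𝔭 1 ≠ ⊥)
    (hdim : n + 2 = 2 * p + Module.finrank k (invForms k p 𝔭 1)) :
    n + 1 = 2 * p ∧ ∃ (c : Fin (n + 1) → k) (y : Fin 2 → k), c 0 = 1 ∧ LinearIndependent (frobPow k p 1) c ∧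
      𝔭 = ratPoint k p 1 c ∧ PIndep p 1 y ∧ Set.range y ⊆ Set.range c ∧
      Set.range c ⊆ (IntermediateField.adjoin (frobPow k p 1) (Set.range y) : Set k) := by
  obtain ⟨c, y, s, b, hb, hc, hc0, hcind, heq, hy, hyc, hcy, -, -⟩ := exists_adapted_pair_of_extremal k p 𝔭 hP h0 hV hdim
  exact ⟨(card_eq_of_extremal k p 𝔭 hP h0 hV hdim).1, c, y, hc0, hcind, heq, hy, hyc, hcy⟩

/-- **The same in Hironaka's / Mizutani's own vocabulary** (`U(𝔭) ∩ L_0 = 0`, exponent `1`, `dim B_{P,𝔭} + 1 = 2p`): `n + 1 = 2p`, one invariant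
form (`dim_k (U(𝔭) ∩ L)_1 = 1`), and `𝔭 = [c^{1/p}]` with the `2p` independent `c_i` in `k^p(y_1, y_2)`, `y ⊆ {c_i}` `p`-independent.
[cite: Mizutani1973HironakaGroupSchemes, Thm. 2.8 (second part)] -/
theorem exists_pair_of_exponent_eq_one [𝔭.IsPrime] (hP : IsPoint k 𝔭) (hlin : hirForms k p 𝔭 0 = ⊥) (hexp : exponent k p 𝔭 = 1)
    (hdim : ringKrullDim (MvPolynomial (Fin (n + 1)) k ⧸ bIdeal k 𝔭) + 1 = (2 * p : WithBot ℕ∞)) :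
    n + 1 = 2 * p ∧ Module.finrank k (hirForms k p 𝔭 1) = 1 ∧ ∃ (c : Fin (n + 1) → k) (y : Fin 2 → k), c 0 = 1 ∧
      LinearIndependent (frobPow k p 1) c ∧ 𝔭 = ratPoint k p 1 c ∧ PIndep p 1 y ∧ Set.range y ⊆ Set.range c ∧
      Set.range c ⊆ (IntermediateField.adjoin (frobPow k p 1) (Set.range y) : Set k) := by
  have h0 : invForms k p 𝔭 0 = ⊥ := by rw [← hirForms_eq_invForms 𝔭 0]; exact hlin
  have hV := invForms_one_ne_bot_of_exponent_eq_one k p 𝔭 hexp h0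
  have hE1 : ExponentLE k p 𝔭 1 := ((exponent_eq_iff k p 𝔭).mp hexp).1
  rw [ringKrullDim_quotient_bIdeal_eq_hsDim_holds k p 𝔭 hP, ← hsDimAt_eq_hsDim k p 𝔭 hE1] at hdim
  have h1 : hsDimAt k p 𝔭 1 + 1 = 2 * p := by exact_mod_cast hdim
  unfold hsDimAt at h1
  have hfin := finrank_invForms_le k p 𝔭 1
  have hdim' : n + 2 = 2 * p + Module.finrank k (invForms k p 𝔭 1) := by omega
  obtain ⟨hn, c, y, hc0, hcind, heq, hy, hyc, hcy⟩ := exists_pair_of_extremal k p 𝔭 hP h0 hV hdim'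
  refine ⟨hn, ?_, c, y, hc0, hcind, heq, hy, hyc, hcy⟩
  rw [hirForms_eq_invForms 𝔭 1]
  exact (card_eq_of_extremal k p 𝔭 hP h0 hV hdim').2

end StepTwo

end Summit.ResolutionOfSingularities.KangarooAtlas.Mizutani

end
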